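import Mathlib

/-!
# Sketch — crux-ideate stmt-HodgeConjecture-14393 (TwinTwistorTransport), round 1, ideator 2

First lemmas (linear-algebra / lattice shadows over Mathlib only) for the two idea cards

* `mukai-lift-full-similitude`  — `mukaiBlock_twoSimilitude`, `hilbSquare_to_hilbCube`,
  `similitude_preserves_orthogonality` (no-pinning criterion, easy direction);
* `nikulin-disc-adjacency-bek` — `mixed_class_in_span_of_products` (Künneth–Tate shadow at an
  anchor where all of H² is algebraic on both factors).
-/

namespace CruxIdea14393k2

open Matrix

/-- The rank-2 "Mukai hyperbolic block" `U` with pairing `-(r s' + r' s)` on `H⁰ ⊕ H⁴`. -/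
def hyp : Matrix (Fin 2) (Fin 2) ℤ := !![0, -1; -1, 0]

/-- The completion of a 2-similitude on `H²` to the Mukai lattice: `(r, s) ↦ (r, 2 s)`. -/
def dbl : Matrix (Fin 2) (Fin 2) ℤ := !![1, 0; 0, 2]

/-- `dbl` is a 2-similitude of the hyperbolic block. -/
theorem dbl_twoSimilitude : dblᵀ * hyp * dbl = 2 • hyp := by decide

/-- MUKAI LIFT (card `mukai-lift-full-similitude`, first lemma): if `M` is a 2-similitude of a
Gram matrix `G` (`Mᵀ G M = 2 G`, e.g. the twin similitude `Ψ` on `H²`), then `M ⊕ dbl` is a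
2-similitude of the Mukai-type form `G ⊕ hyp`. -/
theorem mukaiBlock_twoSimilitude {n : ℕ} (G M : Matrix (Fin n) (Fin n) ℤ)
    (hM : Mᵀ * G * M = 2 • G) :
    (fromBlocks M 0 0 dbl)ᵀ * fromBlocks G 0 0 hyp * fromBlocks M 0 0 dbl
      = 2 • fromBlocks G 0 0 hyp := by
  rw [fromBlocks_transpose, fromBlocks_multiply, fromBlocks_multiply, fromBlocks_smul]
  simp [hM, dbl_twoSimilitude]

/-- The Hilbert-square vector `w = (1,0,-1)` (here its `U`-part `(1,-1)`, square `2`) is sent by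
`dbl` to the Hilbert-CUBE vector `v = (1,0,-2)` (U-part `(1,-2)`, square `4`), and the class
`δ₂ ↔ (1,0,1)` (square `-2`) to `δ₃ ↔ (1,0,2)` (square `-4`): so the twin similitude restricts to a
2-similitude of FULL second cohomology `H²(S″^[2]) = w^⊥ → v^⊥ = H²(S^[3])`. -/
theorem hilbSquare_to_hilbCube :
    dbl *ᵥ ![1, -1] = ![1, -2] ∧ dbl *ᵥ ![1, 1] = ![1, 2] ∧
    ![1, -1] ⬝ᵥ (hyp *ᵥ ![1, -1]) = 2 ∧ ![(1 : ℤ), -2] ⬝ᵥ (hyp *ᵥ ![1, -2]) = 4 ∧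
    ![1, 1] ⬝ᵥ (hyp *ᵥ ![1, 1]) = -2 ∧ ![(1 : ℤ), 2] ⬝ᵥ (hyp *ᵥ ![1, 2]) = -4 ∧
    ![1, -1] ⬝ᵥ (hyp *ᵥ ![1, 1]) = 0 ∧ ![(1 : ℤ), -2] ⬝ᵥ (hyp *ᵥ ![1, 2]) = 0 := by
  decide

/-- NO PINNING (easy direction): a similitude of the WHOLE space preserves orthogonality, hence
maps the orthogonal complement of the period to the orthogonal complement of the image period —
so the Hodge locus of a full-`H²` similitude is cut out by the `(2,0)`-condition alone
(contrast: a correspondence `f` with `f_† f = 2 ⊕ 0 ⊕ 1`, e.g. `g^[2]*` for a Nikulin double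
cover, pins the period to an eigenspace). -/
theorem similitude_preserves_orthogonality {K V V'' : Type*} [Field K]
    [AddCommGroup V] [Module K V] [AddCommGroup V''] [Module K V'']
    (B : V →ₗ[K] V →ₗ[K] K) (B'' : V'' →ₗ[K] V'' →ₗ[K] K) (c : K)
    (f : V'' →ₗ[K] V) (hf : ∀ x y, B (f x) (f y) = c * B'' x y)
    (σ x : V'') (hx : B'' x σ = 0) : B (f x) (f σ) = 0 := by
  rw [hf, hx, mul_zero]

/-- KÜNNETH–TATE SHADOW (card `nikulin-disc-adjacency-bek`, first lemma): at an anchor where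
both second cohomologies are spanned by algebraic (divisor) classes — a supersingular twin pair —
every mixed class, in particular the reduction of the twin similitude, is a finite sum of exterior
products of algebraic classes: here for linear maps, every `f : V'' → V` is a sum of rank-one maps
built from a basis of `V` and coordinates of `V''`. -/
theorem mixed_class_in_span_of_products {K V V'' : Type*} [Field K]
    [AddCommGroup V] [Module K V] [AddCommGroup V''] [Module K V'']
    {ι : Type*} [Fintype ι] (b : Module.Basis ι K V) (f : V'' →ₗ[K] V) :
    f = ∑ i, (((b.coord i).comp f)).smulRight (b i) := by
  ext x
  simp only [LinearMap.coe_sum, Finset.sum_apply, LinearMap.smulRight_apply,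
    LinearMap.coe_comp, Function.comp_apply, Module.Basis.coord_apply]
  exact (b.sum_repr (f x)).symm

end CruxIdea14393k2
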